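import Summits.BirchSwinnertonDyer.BirchSwinnertonDyer.Theorems.AlignedTransportAtTwoMainConjectureOfRankZeroBSDAtTwoCubicPrimesOfEmbeddings
import Summits.BirchSwinnertonDyer.BirchSwinnertonDyer.Theorems.ByReductionTypeAtTwoFineSelmerConjAAtTwoAdditivePotGoodTwoLayerDoor
import HarnessLib

/-!
# Route `AlignedTransportAtTwo`, crux C2 `MainConjectureOfRankZeroBSDAtTwo` (stmt-BirchSwinnertonDyer-22298):
# THE OFF-STRATUM CLASS-GROUP DOOR — for a seed-cell curve with `Δ_W < 0` and `Δ_min ≢ 1 (mod 8)` the layer-`(0,1)` Chevalley door of cell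
# bsd-2adic fires with its structure input «at most two primes above `2` in `ℚ(e₁)`» DISCHARGED (att-p5 g26 `…CubicOffStratumPrimes`)

HONEST FRAMING (cell `bsd-f1-sign2`, WIDTH-5 attached prover seat `bsd-line-att-p5` gen 26 on line `birth` of the lead `bsd-line-att-p2`;
`--supports` stmt-BirchSwinnertonDyer-22298, closes nothing; BSD is NOT proved by any of this; the crux C2, its verdict «blocked-on
`Rank1Residual.GreenbergMuConjectureIrreducible`» and every registered stub are untouched). THEOREMS ONLY — no definition, no named fact,
no `sorry`. Complement of this gen's `…CubicKilfordPrimes` §3 (the Kilford sub-cell's layer-`(n, n+1)` doors, `n ≥ 1` forced by parity): OFF the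
stratum the cubic field `ℚ(β)` has EXACTLY two primes above `2` (`…CubicPrimesOfEmbeddings.ncard_eq_two_of_not_onKilfordStratumAtTwo`), so cell
bsd-2adic's Chevalley door (`AddKatoTwo.classNumberPExp_one_eq_zero_of_nonNorm_unit_two`: odd degree, `h` odd, AT MOST TWO primes above `2`, a unit
that is not a norm from `K(√2)` ⟹ `e₁(κ) = 0`) composes with its two-layer door (`AddKatoTwo.classicalMuVanishes_two_of_oddRamification_of_layerOne`)
and att-p5 g24's cubic carrier (`…CubicCarrierRoad.mazurMainConjecture_two_of_muIneqRel_of_classicalMu_cubicField_of_Δ_neg`) into a door to `MC₂(W)`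
whose number-field STRUCTURE input is kernel; what it still DISPLAYS is class-group/unit data of `ℚ(β)` (`h(ℚ(β))` odd, a non-norm unit) and the
ramification bit «every prime of `ℚ(β)` above `2` has odd index» (true iff `Δ_min ≡ 5 (mod 8)`; NOT kernel — the residue degree of the second prime is
invisible on `c_W mod 2 = y²(y+1)`). No certified seed of the cell lies OFF the stratum today (all twelve have `Δ_min ≡ 1 (mod 8)`); this is the door
for the complementary sub-cell.

WHAT.
* **`classicalMuVanishes_adjoin_of_not_onKilfordStratumAtTwo_of_chevalley`**: `W/ℚ` with `E_W(ℚ)[2] = 0` OFF the Kilford stratum, `β` a root of the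
  `2`-division cubic, `h(ℚ(β))` odd, every prime of `ℚ(β)` above `2` of odd index, a unit `ε ∈ 𝓞 ℚ(β)` with `ε ≠ a² − 2b²` ⟹ `μ₂ = 0` (indeed
  `e_n = 0` for all `n`) for every cyclotomic `ℤ₂`-extension of `ℚ(β)`.
* **`mazurMainConjecture_two_of_muIneqRel_of_not_onKilfordStratumAtTwo_of_chevalley`** and its decidable form
  **`…_of_minimalDiscriminantInt_emod_eight_ne_one_of_chevalley`**: PRINT⁵ + MuIneqʳ (verbatim) + the cell hypotheses + `Δ_W < 0` + OFF the stratum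
  (resp. `Δ_min % 8 ≠ 1`) + the three displayed bits ⟹ `MC₂(W)`.

Nothing is asserted about any curve's class groups or units; nothing is closed; BSD is not proved.

References: [Lang1990] Ch. 13 §4, Lemma 4.1; [Washington1997] §13.1, Lemma 13.3; [Fukuda1994] Thm. 1 (1), p. 264; [NeukirchANT1999] Ch. II §8;
[Iwasawa1973MuInvariants] Thm. 2/3; [Kato2004Asterisque] Thm. 17.4; [GreenbergLNM1716] Conj. 1.11, Thm. 4.1; tree: bsd-2adic k4-w1 `…ChevalleyDoorAtTwo` /
`…TwoLayerDoor`, att-p5 g24 p739408, g26 p747403 / p747642.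
-/

set_option linter.dupNamespace false
set_option autoImplicit false

noncomputable section

open scoped Classical NumberField nonZeroDivisors

namespace Summit.BirchSwinnertonDyer.BirchSwinnertonDyer.Theorems.AlignedTransportAtTwoCubicOffStratumChevalleyDoor

open NumberField IsDedekindDomain Polynomial WeierstrassCurve IntermediateField CongruenceSubgroup
  Literature.NumberTheory.IwasawaTheory Literature.NumberTheory.GaloisRepresentations
  Literature.NumberTheory.EllipticCurves Literature.NumberTheory.EllipticCurves.Greenberg1999
  Literature.NumberTheory.EllipticCurves.ModularForms
  Literature.NumberTheory.EllipticCurves.Rank1Residual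
  Literature.NumberTheory.EllipticCurves.Module
  Summit.BirchSwinnertonDyer.Rank1Residual
  Summit.BirchSwinnertonDyer.Rank1Residual.X1.MuLambda
  Summit.BirchSwinnertonDyer.Rank1Residual.X5
  Summit.BirchSwinnertonDyer.Rank1Residual.F1Sign2
  Summit.BirchSwinnertonDyer.BirchSwinnertonDyer.Theorems.Rank1ResidualX1Defs
  Summit.BirchSwinnertonDyer.BirchSwinnertonDyer.Theses.AlignedTransportAtTwo
  Summit.BirchSwinnertonDyer.BirchSwinnertonDyer.Theorems.AlignedTransportAtTwoKilfordStratumShared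
  Summit.BirchSwinnertonDyer.BirchSwinnertonDyer.Theorems.AlignedTransportAtTwoCubicCarrierRoad
  Summit.BirchSwinnertonDyer.BirchSwinnertonDyer.Theorems.AlignedTransportAtTwoCubicOffStratumPrimes

variable (W : WeierstrassCurve ℚ) [W.IsElliptic]

/-- **`μ₂(ℚ(β)^{cyc}) = 0` OFF THE STRATUM, by Chevalley's door with its structure input discharged.** `W/ℚ` with no rational `2`-torsion
abscissa OFF the Kilford stratum, `β ∈ ℚ̄` a root of `4x³ + b₂x² + 2b₄x + b₆`; displayed: `h(ℚ(β))` odd, every prime of `ℚ(β)` above `2` of odd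
index, a unit `ε` of `𝓞 ℚ(β)` that is not of the form `a² − 2b²`. Then every cyclotomic `ℤ₂`-extension of `ℚ(β)` has `μ = 0` (`e_n = 0` for all
`n`): «at most two primes above `2`» is `…CubicOffStratumPrimes.ncard_adjoin_le_two_of_not_onKilfordStratumAtTwo`, the degree `3` is odd, and
bsd-2adic's `classNumberPExp_one_eq_zero_of_nonNorm_unit_two` + `classicalMuVanishes_two_of_oddRamification_of_layerOne` conclude.
[cite: Lang1990, Ch. 13 §4, Lemma 4.1] [cite: Fukuda1994, Thm. 1 (1), p. 264] [cite: Washington1997, §13.1 Lemma 13.3] -/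
theorem classicalMuVanishes_adjoin_of_not_onKilfordStratumAtTwo_of_chevalley (ht : ∀ x : ℚ, ¬ HasRationalTwoTorsionX W x)
    (hs : ¬ OnKilfordStratumAtTwo W) {β : AlgebraicClosure ℚ} (hβ : aeval β W.twoTorsionPolynomial.toPoly = 0)
    (hh : haveI : FiniteDimensional ℚ ↥(IntermediateField.adjoin ℚ ({β} : Set (AlgebraicClosure ℚ))) :=
        IntermediateField.adjoin.finiteDimensional ((AlgebraicClosure.isAlgebraic ℚ).isAlgebraic β).isIntegral
      haveI : NumberField ↥(IntermediateField.adjoin ℚ ({β} : Set (AlgebraicClosure ℚ))) := NumberField.mk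
      ¬ 2 ∣ classNumber ↥(IntermediateField.adjoin ℚ ({β} : Set (AlgebraicClosure ℚ))))
    (hodd : ∀ w : HeightOneSpectrum (𝓞 ↥(IntermediateField.adjoin ℚ ({β} : Set (AlgebraicClosure ℚ)))),
      ((2 : ℕ) : 𝓞 ↥(IntermediateField.adjoin ℚ ({β} : Set (AlgebraicClosure ℚ)))) ∈ w.asIdeal → Odd (w.asIdeal.ramificationIdx ℤ))
    {ε : 𝓞 ↥(IntermediateField.adjoin ℚ ({β} : Set (AlgebraicClosure ℚ)))} (hεu : IsUnit ε)
    (hnn : ∀ a b : ↥(IntermediateField.adjoin ℚ ({β} : Set (AlgebraicClosure ℚ))),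
      (ε : ↥(IntermediateField.adjoin ℚ ({β} : Set (AlgebraicClosure ℚ)))) ≠ a ^ 2 - 2 * b ^ 2)
    (κP : ZpExtension ↥(IntermediateField.adjoin ℚ ({β} : Set (AlgebraicClosure ℚ))) 2) (hκP : κP.IsCyclotomic) :
    ClassicalMuVanishes κP := by
  have hirr := AlignedTransportAtTwoSeed.irr_two_of_forall_not_hasRationalTwoTorsionX W ht
  have hβint : IsIntegral ℚ β := ((AlgebraicClosure.isAlgebraic ℚ).isAlgebraic β).isIntegral
  haveI : FiniteDimensional ℚ ↥(IntermediateField.adjoin ℚ ({β} : Set (AlgebraicClosure ℚ))) :=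
    IntermediateField.adjoin.finiteDimensional hβint
  haveI : NumberField ↥(IntermediateField.adjoin ℚ ({β} : Set (AlgebraicClosure ℚ))) := NumberField.mk
  have h3 : Module.finrank ℚ ↥(IntermediateField.adjoin ℚ ({β} : Set (AlgebraicClosure ℚ))) = 3 :=
    AddKatoTwo.finrank_adjoin_root_twoTorsionPolynomial_eq_three W hirr hβ
  have hodd3 : ¬ 2 ∣ Module.finrank ℚ ↥(IntermediateField.adjoin ℚ ({β} : Set (AlgebraicClosure ℚ))) := by rw [h3]; decide
  have hs2 := ncard_adjoin_le_two_of_not_onKilfordStratumAtTwo W ht hs hβ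
  have h1 : classNumberPExp κP 1 = 0 :=
    AddKatoTwo.classNumberPExp_one_eq_zero_of_nonNorm_unit_two hodd3 κP hκP hh hs2 hεu hnn
  have hh' : ¬ 2 ∣ Nat.card (ClassGroup (𝓞 ↥(IntermediateField.adjoin ℚ ({β} : Set (AlgebraicClosure ℚ))))) := by
    rwa [NumberField.classNumber, ← Nat.card_eq_fintype_card] at hh
  exact AddKatoTwo.classicalMuVanishes_two_of_oddRamification_of_layerOne _ hodd3 hodd κP hκP hh' h1

variable [W.IsGloballyMinimal]

/-- **THE OFF-STRATUM DOOR INTO `MC₂(W)`.** PRINT⁵ {Kato 17.4 (1)(2) at `2` (`h17`), Greenberg 4.1 (`hGr`), period unit (`hper`), modularity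
(`hmod`), GZK (`hGZK`)} + MuIneqʳ (`hI`, the registered stub VERBATIM) + the cell hypotheses (good ordinary at `2`, no rational `2`-torsion abscissa,
`Δ_W < 0`, `r_an = 0`, analytic `μ₂ = 0` on the even branch, `BSD₂(W)`) + OFF the Kilford stratum + `β` a root of the `2`-division cubic + the three
displayed bits (`h(ℚ(β))` odd, odd indices above `2`, a non-norm unit) ⟹ `MC₂(W)` (att-p5 g24 `…CubicCarrierRoad` §2 ∘ the previous theorem).
[cite: Fukuda1994, Thm. 1 (1), p. 264] [cite: Kato2004Asterisque, Thm. 17.4 (1)(2) (p. 273)] [cite: GreenbergLNM1716, Thm. 4.1 (p. 102) and Conj. 1.11 (p. 58)]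
[cite: Iwasawa1973MuInvariants, Thm. 2 and Thm. 3] [cite: Lang1990, Ch. 13 §4, Lemma 4.1] -/
theorem mazurMainConjecture_two_of_muIneqRel_of_not_onKilfordStratumAtTwo_of_chevalley
    (h17 : ∀ [NeZero (W.conductorNorm ℤ)] (f : CuspForm (Gamma0 (W.conductorNorm ℤ)) 2),
      kato_divisibility_allPrimes W 2 (f := f))
    (hGr : Greenberg1999.thm41_charValue_rankZero_anyPrime)
    (hper : realPeriodRat_eq_unit_mul_plusPeriod_two) (hmod : nonempty_modularParametrizationData)
    (hGZK : rank_eq_analyticRank_of_analyticRank_le_one)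
    (hI : ∀ (W : WeierstrassCurve ℚ) [W.IsElliptic] [W.IsGloballyMinimal], IsOrdinaryAt W 2 →
      (∀ x : ℚ, ¬ HasRationalTwoTorsionX W x) →
      ∀ (κ : ZpExtension ℚ 2) (γ : Field.absoluteGaloisGroup ℚ), κ.IsCyclotomic →
      κ.IsTopGenerator γ → IsCyclotomicVariable 2 γ →
      ∀ ⦃N : ℕ⦄ [NeZero N] (f : CuspForm (Gamma0 N) 2), IsNewformOf W f →
      ∀ Gp : IwasawaAlgebra 2, iwasawaToPowerSeries 2 Gp = padicLFunction f (unitRoot W 2 : ℚ_[2]) →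
      ∀ (D : W.SelmerDualData κ γ) (Yr : W.FineSelmerDualDataRelaxedInf κ γ),
        lengthAt (IwasawaAlgebra 2) D.X ⟨IwasawaAlgebra.augIdealP 2, IwasawaAlgebra.isPrime_augIdealP_holds 2⟩ ≤
          lengthAt (IwasawaAlgebra 2) (IwasawaAlgebra 2 ⧸ Ideal.span {Gp})
              ⟨IwasawaAlgebra.augIdealP 2, IwasawaAlgebra.isPrime_augIdealP_holds 2⟩ +
            lengthAt (IwasawaAlgebra 2) Yr.X ⟨IwasawaAlgebra.augIdealP 2, IwasawaAlgebra.isPrime_augIdealP_holds 2⟩)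
    (hord : IsOrdinaryAt W 2) (ht : ∀ x : ℚ, ¬ HasRationalTwoTorsionX W x) (hΔ : W.Δ < 0) (hr : W.analyticRank = 0)
    (hμan : ∀ ⦃N : ℕ⦄ [NeZero N] (f : CuspForm (Gamma0 N) 2), IsNewformOf W f →
      ∀ G : IwasawaAlgebra 2, IsEvenBranchLiftAtTwo W f G → red G ≠ 0)
    (hbsd : BSDp W 2) (hs : ¬ OnKilfordStratumAtTwo W)
    {β : AlgebraicClosure ℚ} (hβ : aeval β W.twoTorsionPolynomial.toPoly = 0)
    (hh : haveI : FiniteDimensional ℚ ↥(IntermediateField.adjoin ℚ ({β} : Set (AlgebraicClosure ℚ))) :=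
        IntermediateField.adjoin.finiteDimensional ((AlgebraicClosure.isAlgebraic ℚ).isAlgebraic β).isIntegral
      haveI : NumberField ↥(IntermediateField.adjoin ℚ ({β} : Set (AlgebraicClosure ℚ))) := NumberField.mk
      ¬ 2 ∣ classNumber ↥(IntermediateField.adjoin ℚ ({β} : Set (AlgebraicClosure ℚ))))
    (hodd : ∀ w : HeightOneSpectrum (𝓞 ↥(IntermediateField.adjoin ℚ ({β} : Set (AlgebraicClosure ℚ)))),
      ((2 : ℕ) : 𝓞 ↥(IntermediateField.adjoin ℚ ({β} : Set (AlgebraicClosure ℚ)))) ∈ w.asIdeal → Odd (w.asIdeal.ramificationIdx ℤ))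
    {ε : 𝓞 ↥(IntermediateField.adjoin ℚ ({β} : Set (AlgebraicClosure ℚ)))} (hεu : IsUnit ε)
    (hnn : ∀ a b : ↥(IntermediateField.adjoin ℚ ({β} : Set (AlgebraicClosure ℚ))),
      (ε : ↥(IntermediateField.adjoin ℚ ({β} : Set (AlgebraicClosure ℚ)))) ≠ a ^ 2 - 2 * b ^ 2) :
    MazurMainConjecture W 2 :=
  mazurMainConjecture_two_of_muIneqRel_of_classicalMu_cubicField_of_Δ_neg W h17 hGr hper hmod hGZK hI hord ht hΔ hr hμan hbsd hβ
    fun κP hκP => classicalMuVanishes_adjoin_of_not_onKilfordStratumAtTwo_of_chevalley W ht hs hβ hh hodd hεu hnn κP hκP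

/-- **THE OFF-STRATUM DOOR, decidable form**: the same with `Δ_min(W) % 8 ≠ 1` (good ordinary at `2` makes it «OFF the stratum», tree
`not_onKilfordStratumAtTwo_iff_minimalDiscriminantInt_emod_eight_ne`). [cite: Serre1973, Ch. II §3.3 Thm. 4] [cite: Fukuda1994, Thm. 1 (1), p. 264]
[cite: Kato2004Asterisque, Thm. 17.4 (1)(2) (p. 273)] [cite: Lang1990, Ch. 13 §4, Lemma 4.1] -/
theorem mazurMainConjecture_two_of_muIneqRel_of_minimalDiscriminantInt_emod_eight_ne_one_of_chevalley
    (h17 : ∀ [NeZero (W.conductorNorm ℤ)] (f : CuspForm (Gamma0 (W.conductorNorm ℤ)) 2),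
      kato_divisibility_allPrimes W 2 (f := f))
    (hGr : Greenberg1999.thm41_charValue_rankZero_anyPrime)
    (hper : realPeriodRat_eq_unit_mul_plusPeriod_two) (hmod : nonempty_modularParametrizationData)
    (hGZK : rank_eq_analyticRank_of_analyticRank_le_one)
    (hI : ∀ (W : WeierstrassCurve ℚ) [W.IsElliptic] [W.IsGloballyMinimal], IsOrdinaryAt W 2 →
      (∀ x : ℚ, ¬ HasRationalTwoTorsionX W x) →
      ∀ (κ : ZpExtension ℚ 2) (γ : Field.absoluteGaloisGroup ℚ), κ.IsCyclotomic →
      κ.IsTopGenerator γ → IsCyclotomicVariable 2 γ →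
      ∀ ⦃N : ℕ⦄ [NeZero N] (f : CuspForm (Gamma0 N) 2), IsNewformOf W f →
      ∀ Gp : IwasawaAlgebra 2, iwasawaToPowerSeries 2 Gp = padicLFunction f (unitRoot W 2 : ℚ_[2]) →
      ∀ (D : W.SelmerDualData κ γ) (Yr : W.FineSelmerDualDataRelaxedInf κ γ),
        lengthAt (IwasawaAlgebra 2) D.X ⟨IwasawaAlgebra.augIdealP 2, IwasawaAlgebra.isPrime_augIdealP_holds 2⟩ ≤
          lengthAt (IwasawaAlgebra 2) (IwasawaAlgebra 2 ⧸ Ideal.span {Gp})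
              ⟨IwasawaAlgebra.augIdealP 2, IwasawaAlgebra.isPrime_augIdealP_holds 2⟩ +
            lengthAt (IwasawaAlgebra 2) Yr.X ⟨IwasawaAlgebra.augIdealP 2, IwasawaAlgebra.isPrime_augIdealP_holds 2⟩)
    (hord : IsOrdinaryAt W 2) (ht : ∀ x : ℚ, ¬ HasRationalTwoTorsionX W x) (hΔ : W.Δ < 0) (hr : W.analyticRank = 0)
    (hμan : ∀ ⦃N : ℕ⦄ [NeZero N] (f : CuspForm (Gamma0 N) 2), IsNewformOf W f →
      ∀ G : IwasawaAlgebra 2, IsEvenBranchLiftAtTwo W f G → red G ≠ 0)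
    (hbsd : BSDp W 2) (h8 : minimalDiscriminantInt W % 8 ≠ 1)
    {β : AlgebraicClosure ℚ} (hβ : aeval β W.twoTorsionPolynomial.toPoly = 0)
    (hh : haveI : FiniteDimensional ℚ ↥(IntermediateField.adjoin ℚ ({β} : Set (AlgebraicClosure ℚ))) :=
        IntermediateField.adjoin.finiteDimensional ((AlgebraicClosure.isAlgebraic ℚ).isAlgebraic β).isIntegral
      haveI : NumberField ↥(IntermediateField.adjoin ℚ ({β} : Set (AlgebraicClosure ℚ))) := NumberField.mk
      ¬ 2 ∣ classNumber ↥(IntermediateField.adjoin ℚ ({β} : Set (AlgebraicClosure ℚ))))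
    (hodd : ∀ w : HeightOneSpectrum (𝓞 ↥(IntermediateField.adjoin ℚ ({β} : Set (AlgebraicClosure ℚ)))),
      ((2 : ℕ) : 𝓞 ↥(IntermediateField.adjoin ℚ ({β} : Set (AlgebraicClosure ℚ)))) ∈ w.asIdeal → Odd (w.asIdeal.ramificationIdx ℤ))
    {ε : 𝓞 ↥(IntermediateField.adjoin ℚ ({β} : Set (AlgebraicClosure ℚ)))} (hεu : IsUnit ε)
    (hnn : ∀ a b : ↥(IntermediateField.adjoin ℚ ({β} : Set (AlgebraicClosure ℚ))),
      (ε : ↥(IntermediateField.adjoin ℚ ({β} : Set (AlgebraicClosure ℚ)))) ≠ a ^ 2 - 2 * b ^ 2) :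
    MazurMainConjecture W 2 :=
  mazurMainConjecture_two_of_muIneqRel_of_not_onKilfordStratumAtTwo_of_chevalley W h17 hGr hper hmod hGZK hI hord ht hΔ hr hμan hbsd
    ((not_onKilfordStratumAtTwo_iff_minimalDiscriminantInt_emod_eight_ne W hord).mpr h8) hβ hh hodd hεu hnn

end Summit.BirchSwinnertonDyer.BirchSwinnertonDyer.Theorems.AlignedTransportAtTwoCubicOffStratumChevalleyDoor

end
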